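import Summits.QuantumFields.YangMills.Theorems.FemtoTransferGapReduction

/-!
# Femto transfer gap — the one-site Lipschitz seam is a corollary of `OneSiteLevels`

Support module for route `LuscherReduction` (QuantumFields / YangMills; rung leaf `FemtoGapOfRecord`), crux `RunningReduction`
(item `stmt-QuantumFields-19978`).  The registered birth skeleton of `RunningReduction` composes four stubs
`S1 StiffModeDecoupling → S2 OneSiteLipschitz → S3 TransferValuesNonneg → S4 OneSiteTopPos → RunningReduction`.
This file proves that **S2 is not an independent difficulty**: the Lipschitz regularity in the bare running parameter
`λ_b = (2/B)^{1/3}` of the one-site log level ratios,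
`λ_k(B)·λ₀(B') ≤ exp(C(|λ_b − λ_b'| + λ_b² + λ_b'²))·λ_k(B')·λ₀(B)` for `B, B' ≥ B₀`,
follows by two lines of algebra from the two-sided one-site level asymptotics `OneSiteLevels` (the route's OTHER crux, item
`stmt-QuantumFields-20007`): divide the upper bound at `B` by the lower bound at `B'`; the exponent
`ε_k(λ_b' − λ_b) + C(λ_b² + λ_b'²)` is at most `(|ε_k| + |C|)(|λ_b − λ_b'| + λ_b² + λ_b'²)`.
Consequently the line for `RunningReduction` reduces to `S1` given `OneSiteLevels` (and the elementary `S3`, `S4`), i.e. the route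
`closes` from `StiffModeDecoupling ∧ OneSiteLevels` — recorded for the lead prover / a reshaped skeleton; no statement of the route changes.

The conclusion of `oneSiteLipschitz_of_oneSiteLevels` below is VERBATIM the registered stub statement `Stmt.stub_oneSiteLipschitz`
(`Cruxes/RunningReduction/Lines/birth.lean`), so `theorem stub_oneSiteLipschitz : Stmt.stub_oneSiteLipschitz :=
oneSiteLipschitz_of_oneSiteLevels h` discharges it under `h : OneSiteLevels` (the route item `Theses.LuscherReduction.OneSiteLevels`
is rfl-equal to the tree decl used here).

WHAT THIS IS NOT: not a proof of `OneSiteLevels` (open: semiclassical multi-well asymptotics of the one-site transfer operator), not a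
statement about Yang–Mills beyond the one-site model, NOT THE CLAY GAP.  No `sorry`, no new axioms.
-/

set_option autoImplicit false

noncomputable section

open Real
open Literature.MathematicalPhysics.QuantumFieldTheory
open Literature.MathematicalPhysics.QuantumLattice
open Literature.Analysis.OperatorTheory.YMMatrixModel

namespace Summit.QuantumFields.YangMills.Theorems.FemtoTransferGap

/-- Elementary exponent bound: `-(εx − Cx²) + (εy + Cy²) ≤ (|ε| + |C|)(|x − y| + (x² + y²))`. -/
theorem lipschitz_exponent_le (ε C x y : ℝ) :
    -(ε * x - C * x ^ 2) + (ε * y + C * y ^ 2) ≤ (|ε| + |C|) * (|x - y| + (x ^ 2 + y ^ 2)) := by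
  have hxy : 0 ≤ |x - y| := abs_nonneg _
  have hsq : 0 ≤ x ^ 2 + y ^ 2 := add_nonneg (sq_nonneg x) (sq_nonneg y)
  have e1 : ε * (y - x) ≤ |ε| * |x - y| := by
    calc ε * (y - x) ≤ |ε * (y - x)| := le_abs_self _
      _ = |ε| * |x - y| := by rw [abs_mul, abs_sub_comm]
  have e2 : C * (x ^ 2 + y ^ 2) ≤ |C| * (x ^ 2 + y ^ 2) :=
    mul_le_mul_of_nonneg_right (le_abs_self C) hsq
  have e3 : |ε| * |x - y| ≤ (|ε| + |C|) * |x - y| :=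
    mul_le_mul_of_nonneg_right (le_add_of_nonneg_right (abs_nonneg C)) hxy
  have e4 : |C| * (x ^ 2 + y ^ 2) ≤ (|ε| + |C|) * (x ^ 2 + y ^ 2) :=
    mul_le_mul_of_nonneg_right (le_add_of_nonneg_left (abs_nonneg ε)) hsq
  calc -(ε * x - C * x ^ 2) + (ε * y + C * y ^ 2) = ε * (y - x) + C * (x ^ 2 + y ^ 2) := by ring
    _ ≤ |ε| * |x - y| + |C| * (x ^ 2 + y ^ 2) := add_le_add e1 e2
    _ ≤ (|ε| + |C|) * |x - y| + (|ε| + |C|) * (x ^ 2 + y ^ 2) := add_le_add e3 e4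
    _ = (|ε| + |C|) * (|x - y| + (x ^ 2 + y ^ 2)) := by ring

/-- Under `OneSiteLevels`, every one-site transfer value is non-negative beyond the threshold (from the lower bound and `0 < λ₀`). -/
theorem oneSite_levelValue_nonneg_of_oneSiteLevels (h : OneSiteLevels) (k : ℕ) :
    ∃ B0 : ℝ, ∀ B : ℝ, B0 ≤ B → 0 ≤ levelValue su2Rep 1 B k := by
  obtain ⟨C, B0, hB⟩ := h k
  refine ⟨B0, fun B hBB => ?_⟩
  obtain ⟨h0, -, hlo⟩ := hB B hBB
  exact le_trans (mul_nonneg (Real.exp_pos _).le h0.le) hlo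

/-- **S2 ⇐ ONE.**  The one-site Lipschitz seam (VERBATIM the registered stub `Stmt.stub_oneSiteLipschitz` of the `RunningReduction`
birth skeleton: Lipschitz regularity in `λ_b` of the one-site log level ratios, cross-multiplied junk-robust form) follows from the two-sided one-site level asymptotics `OneSiteLevels`, with Lipschitz
constant `|ε_k| + |C_k|` and the same threshold `B₀(k)`. -/
theorem oneSiteLipschitz_of_oneSiteLevels (h : OneSiteLevels) :
    ∀ k : ℕ, ∃ C B0 : ℝ, ∀ B B' : ℝ, B0 ≤ B → B0 ≤ B' →
      levelValue su2Rep 1 B k * levelValue su2Rep 1 B' 0 ≤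
        Real.exp (C * (|bareLambda B - bareLambda B'| + (bareLambda B ^ 2 + bareLambda B' ^ 2))) *
          (levelValue su2Rep 1 B' k * levelValue su2Rep 1 B 0) := by
  intro k
  obtain ⟨C, B0, hB⟩ := h k
  refine ⟨|levelGap k| + |C|, B0, fun B B' hBB hBB' => ?_⟩
  obtain ⟨h0B, hupB, hloB⟩ := hB B hBB
  obtain ⟨h0B', -, hloB'⟩ := hB B' hBB'
  set ε := levelGap k with hε
  set x := bareLambda B with hx
  set y := bareLambda B' with hy
  -- λ₀(B') ≤ e^{εy + Cy²} λ_k(B')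
  have h1 : levelValue su2Rep 1 B' 0 ≤ Real.exp (ε * y + C * y ^ 2) * levelValue su2Rep 1 B' k := by
    have h := mul_le_mul_of_nonneg_left hloB' (Real.exp_pos (ε * y + C * y ^ 2)).le
    rw [← mul_assoc, ← Real.exp_add, add_neg_cancel, Real.exp_zero, one_mul] at h
    exact h
  -- λ_k(B') ≥ 0
  have hkB' : 0 ≤ levelValue su2Rep 1 B' k := le_trans (mul_nonneg (Real.exp_pos _).le h0B'.le) hloB'
  calc levelValue su2Rep 1 B k * levelValue su2Rep 1 B' 0
      ≤ (Real.exp (-(ε * x - C * x ^ 2)) * levelValue su2Rep 1 B 0) *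
          (Real.exp (ε * y + C * y ^ 2) * levelValue su2Rep 1 B' k) :=
        mul_le_mul hupB h1 h0B'.le (mul_nonneg (Real.exp_pos _).le h0B.le)
    _ = Real.exp (-(ε * x - C * x ^ 2) + (ε * y + C * y ^ 2)) *
          (levelValue su2Rep 1 B' k * levelValue su2Rep 1 B 0) := by
        rw [show Real.exp (-(ε * x - C * x ^ 2) + (ε * y + C * y ^ 2)) =
            Real.exp (-(ε * x - C * x ^ 2)) * Real.exp (ε * y + C * y ^ 2) from Real.exp_add _ _]
        ring
    _ ≤ Real.exp ((|ε| + |C|) * (|x - y| + (x ^ 2 + y ^ 2))) *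
          (levelValue su2Rep 1 B' k * levelValue su2Rep 1 B 0) :=
        mul_le_mul_of_nonneg_right (Real.exp_le_exp.mpr (lipschitz_exponent_le ε C x y)) (mul_nonneg hkB' h0B.le)

end Summit.QuantumFields.YangMills.Theorems.FemtoTransferGap

end
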